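import Summits.CriticalPhenomena.PercolationContinuityZ3.Theorems.SahiMasterFamilyTensorisation
import Summits.CriticalPhenomena.PercolationContinuityZ3.Theorems.PercNearOneGluingNoHeavyLowerTailSahiHereditaryMeetAbsorptionCubeFour
import Literature.Combinatorics.Sahi2008.Percolation
import Literature.Combinatorics.Sahi2008.PushForward
import Summits.CriticalPhenomena.PercolationContinuityZ3.Theorems.PercNearOneGluingNoHeavyLowerTailSahiCubeThreeAllOrders

/-!
# Kahn–Sahi positivity on cubes is closed under INDEPENDENT CONJUNCTION of events (tensorisation on `2^{ι₁ ⊔ ι₂}`)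

Companion of `SahiMasterFamilyTensorisation.lean` (crux `NoHeavyLowerTail`, stmt-CriticalPhenomena-4575; cell `prim-masterthm`, seat P4, unit
`prim-masterthm-p4-g3`): the product-measure / cube instance of "Sahi positivity tensorises".  The cube `Set (ι₁ ⊕ ι₂)` with the product weight
`bernoulliWeight (Sum.elim p₁ p₂)` is the product of the cubes `Set ι₁`, `Set ι₂` with their product weights (`pushWeight_glue`), and an event of
the form "`ω ∩ ι₁ ∈ A` and `ω ∩ ι₂ ∈ B`" (a SEPARABLE event `A ⊠ B`, `A` increasing in the `ι₁`-coordinates, `B` in the `ι₂`-coordinates) has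
indicator `1_A(ω|ι₁)·1_B(ω|ι₂)` — a product-form slot.  Hence:

* `sahiE_separable_nonneg` — if `bernoulliWeight p₁` and `bernoulliWeight p₂` are Sahi-positive of all orders `≤ n + 1`, then
  `E_{n+1}(1_{A_0 ⊠ B_0},…,1_{A_n ⊠ B_n}) ≥ 0` under `bernoulliWeight (Sum.elim p₁ p₂)` for all increasing `A_i ⊆ 2^{ι₁}`, `B_i ⊆ 2^{ι₂}`:
  **the class of (cube, weight) pairs satisfying Sahi's `C_{≤ n+1}` is closed under products, on separable families** — every proof of `C_k`
  on small cubes propagates to separable families on the doubled cube.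
* `sahiE_three_separable_nonneg_of_card_le_four` — UNCONDITIONAL instance: `|ι₁|, |ι₂| ≤ 4` (where `C_3` is the tree's kernel theorem
  `sahiPositive_bernoulliWeight_three_of_card_le_four`, and `C_2, C_1` follow): for every product measure on `2^{ι₁ ⊔ ι₂}` (up to 8 coins) and
  all increasing `A_i ⊆ 2^{ι₁}`, `B_i ⊆ 2^{ι₂}`, Sahi's / Kahn's `E_3(A_0 ⊠ B_0, A_1 ⊠ B_1, A_2 ⊠ B_2) ≥ 0` — a new proved class for Kahn's
  Conjecture 5 (e.g. `((x₁∨x₂)(y₁∨y₂), (x₁∨x₃)(y₂∨y₃y₄), (x₂∨x₃)(y₁∨y₄))` on 7 coins), by structure rather than by certificate.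
No named facts; `…CubeFour` is computational upstream (the `|ι| = 4` kernel certificate). [this work]
-/

noncomputable section

namespace Summit.CriticalPhenomena.PercolationContinuityZ3.Theorems

open Finset Function
open Literature.Combinatorics.Sahi2008
open Literature.Probability.Percolation.BHK2006 (weight)
open Literature.Probability.Percolation.DecisionTree (ind ind_of_mem ind_of_not_mem ind_nonneg)

namespace SahiTotalCumulance

variable {ι₁ ι₂ : Type*} [Fintype ι₁] [Fintype ι₂]

/-! ### Gluing two half-configurations -/

/-- The configuration on `ι₁ ⊕ ι₂` with prescribed halves. [this work] -/
def glue (q : Set ι₁ × Set ι₂) : Set (ι₁ ⊕ ι₂) := {x | Sum.elim (fun i => i ∈ q.1) (fun j => j ∈ q.2) x}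

omit [Fintype ι₁] [Fintype ι₂] in
/-- Membership of a left coordinate in a glued configuration. [this work] -/
@[simp] theorem inl_mem_glue (q : Set ι₁ × Set ι₂) (i : ι₁) : (Sum.inl i : ι₁ ⊕ ι₂) ∈ glue q ↔ i ∈ q.1 := Iff.rfl

omit [Fintype ι₁] [Fintype ι₂] in
/-- Membership of a right coordinate in a glued configuration. [this work] -/
@[simp] theorem inr_mem_glue (q : Set ι₁ × Set ι₂) (j : ι₂) : (Sum.inr j : ι₁ ⊕ ι₂) ∈ glue q ↔ j ∈ q.2 := Iff.rfl

omit [Fintype ι₁] [Fintype ι₂] in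
/-- The halves of a glued configuration. [this work] -/
@[simp] theorem preimage_inl_glue (q : Set ι₁ × Set ι₂) : Sum.inl ⁻¹' glue q = q.1 := by
  ext i; simp

omit [Fintype ι₁] [Fintype ι₂] in
/-- The halves of a glued configuration. [this work] -/
@[simp] theorem preimage_inr_glue (q : Set ι₁ × Set ι₂) : Sum.inr ⁻¹' glue q = q.2 := by
  ext j; simp

omit [Fintype ι₁] [Fintype ι₂] in
/-- Every configuration is glued from its halves. [this work] -/
theorem glue_preimages (ω : Set (ι₁ ⊕ ι₂)) : glue (Sum.inl ⁻¹' ω, Sum.inr ⁻¹' ω) = ω := by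
  ext x; cases x <;> simp [glue]

omit [Fintype ι₁] [Fintype ι₂] in
/-- `glue` is injective. [this work] -/
theorem glue_injective : Function.Injective (glue : Set ι₁ × Set ι₂ → Set (ι₁ ⊕ ι₂)) := by
  intro q q' h
  have h1 := congrArg (fun ω => Sum.inl ⁻¹' ω) h
  have h2 := congrArg (fun ω => Sum.inr ⁻¹' ω) h
  simp only [preimage_inl_glue, preimage_inr_glue] at h1 h2
  exact Prod.ext h1 h2

omit [Fintype ι₁] [Fintype ι₂] in
/-- `glue` is monotone (for the coordinatewise order `⊆ × ⊆` and `⊆`). [this work] -/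
theorem glue_monotone : Monotone (glue : Set ι₁ × Set ι₂ → Set (ι₁ ⊕ ι₂)) := by
  intro q q' hqq' x hx
  cases x with
  | inl i => exact hqq'.1 hx
  | inr j => exact hqq'.2 hx

/-- **The product weight on `2^{ι₁ ⊔ ι₂}` factors over the halves.** [folklore] -/
theorem weight_glue (w₁ : ι₁ → ℝ) (w₂ : ι₂ → ℝ) (q : Set ι₁ × Set ι₂) :
    weight (Sum.elim w₁ w₂) (glue q) = weight w₁ q.1 * weight w₂ q.2 := by
  unfold weight
  rw [Fintype.prod_sum_type]
  rfl

/-- **The product measure on `2^{ι₁ ⊔ ι₂}` is the push-forward of the product of the two product measures along `glue`.** [folklore] -/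
theorem pushWeight_glue (p₁ : ι₁ → unitInterval) (p₂ : ι₂ → unitInterval) :
    pushWeight (fun q : Set ι₁ × Set ι₂ => bernoulliWeight p₁ q.1 * bernoulliWeight p₂ q.2) glue =
      bernoulliWeight (Sum.elim p₁ p₂) := by
  funext ω
  rw [← glue_preimages ω, pushWeight_apply_of_injective _ glue_injective]
  have hp : (fun e : ι₁ ⊕ ι₂ => ((Sum.elim p₁ p₂ e : unitInterval) : ℝ)) =
      Sum.elim (fun i => (p₁ i : ℝ)) (fun j => (p₂ j : ℝ)) := by
    funext e; cases e <;> rfl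
  show _ = weight (fun e : ι₁ ⊕ ι₂ => ((Sum.elim p₁ p₂ e : unitInterval) : ℝ)) _
  rw [hp, weight_glue]

/-! ### Separable events -/

omit [Fintype ι₁] [Fintype ι₂] in
/-- The indicator of a separable event pulls back to the product of the two indicators. [this work] -/
theorem ind_separable_comp_glue (A : Set (Set ι₁)) (B : Set (Set ι₂)) :
    (ind {ω : Set (ι₁ ⊕ ι₂) | Sum.inl ⁻¹' ω ∈ A ∧ Sum.inr ⁻¹' ω ∈ B}) ∘ glue =
      fun q : Set ι₁ × Set ι₂ => ind A q.1 * ind B q.2 := by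
  funext q
  simp only [Function.comp_apply, ind, Set.mem_setOf_eq, preimage_inl_glue, preimage_inr_glue]
  by_cases hA : q.1 ∈ A <;> by_cases hB : q.2 ∈ B <;> simp [hA, hB]

omit [Fintype ι₁] in
/-- The indicator of an increasing event is monotone. [folklore] -/
theorem monotone_ind_of_isUpperSet {A : Set (Set ι₁)} (hA : IsUpperSet A) : Monotone (ind A) := by
  intro a b hab
  by_cases ha : a ∈ A
  · rw [ind_of_mem ha, ind_of_mem (hA hab ha)]
  · rw [ind_of_not_mem ha]; exact ind_nonneg _ _

/-- **Independent conjunction preserves Sahi positivity on cubes** (every order): if the product weights on `2^{ι₁}` and `2^{ι₂}` are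
Sahi-positive of all orders `≤ n + 1`, then for increasing `A_i ⊆ 2^{ι₁}`, `B_i ⊆ 2^{ι₂}` the separable events
`A_i ⊠ B_i = {ω : ω|ι₁ ∈ A_i, ω|ι₂ ∈ B_i}` have `E_{n+1}(1_{A_0 ⊠ B_0},…,1_{A_n ⊠ B_n}) ≥ 0` under the product weight on `2^{ι₁ ⊔ ι₂}`. [this work] -/
theorem sahiE_separable_nonneg (p₁ : ι₁ → unitInterval) (p₂ : ι₂ → unitInterval) (n : ℕ)
    (h₁ : ∀ L ≤ n + 1, SahiPositive (bernoulliWeight p₁) L) (h₂ : ∀ L ≤ n + 1, SahiPositive (bernoulliWeight p₂) L)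
    (A : Fin (n + 1) → Set (Set ι₁)) (B : Fin (n + 1) → Set (Set ι₂))
    (hA : ∀ i, IsUpperSet (A i)) (hB : ∀ i, IsUpperSet (B i)) :
    0 ≤ sahiE (bernoulliWeight (Sum.elim p₁ p₂)) (n + 1)
      (fun i => ind {ω : Set (ι₁ ⊕ ι₂) | Sum.inl ⁻¹' ω ∈ A i ∧ Sum.inr ⁻¹' ω ∈ B i}) := by
  rw [← pushWeight_glue, sahiE_pushWeight]
  have hfam : (fun i => (ind {ω : Set (ι₁ ⊕ ι₂) | Sum.inl ⁻¹' ω ∈ A i ∧ Sum.inr ⁻¹' ω ∈ B i}) ∘ glue) =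
      fun i (q : Set ι₁ × Set ι₂) => ind (A i) q.1 * ind (B i) q.2 := by
    funext i
    exact ind_separable_comp_glue (A i) (B i)
  rw [hfam]
  exact sahiE_prod_tensor_nonneg' (bernoulliWeight p₁) (bernoulliWeight p₂) n h₁ h₂ (fun i => ind (A i)) (fun i => ind (B i))
    (fun i x => ind_nonneg _ _) (fun i => monotone_ind_of_isUpperSet (hA i)) (fun i y => ind_nonneg _ _)
    (fun i => monotone_ind_of_isUpperSet (hB i))

/-- Orders `≤ 3` of the product weight on at most four coins (`C_3` is the tree's kernel theorem, `C_{≤2}` follow). [this work] -/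
theorem sahiPositive_bernoulliWeight_le_three_of_card_le_four (hι : Fintype.card ι₁ ≤ 4) (p : ι₁ → unitInterval) :
    ∀ L ≤ 3, SahiPositive (bernoulliWeight p) L := by
  intro L hL
  have h3 := SahiHereditaryMeetAbsorption.sahiPositive_bernoulliWeight_three_of_card_le_four hι p
  exact h3.anti (isFKGMeasure_bernoulliWeight p).nonneg (sum_bernoulliWeight p) hL

/-- **A new unconditional class for Kahn's Conjecture 5 / Sahi's `C_3`**: on `2^{ι₁ ⊔ ι₂}` with `|ι₁|, |ι₂| ≤ 4` and ANY product measure,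
every separable triple `(A_0 ⊠ B_0, A_1 ⊠ B_1, A_2 ⊠ B_2)` (`A_i` increasing in the `ι₁`-coordinates, `B_i` in the `ι₂`-coordinates) has
`E_3 ≥ 0`. [this work] -/
theorem sahiE_three_separable_nonneg_of_card_le_four (hι₁ : Fintype.card ι₁ ≤ 4) (hι₂ : Fintype.card ι₂ ≤ 4)
    (p₁ : ι₁ → unitInterval) (p₂ : ι₂ → unitInterval) (A : Fin 3 → Set (Set ι₁)) (B : Fin 3 → Set (Set ι₂))
    (hA : ∀ i, IsUpperSet (A i)) (hB : ∀ i, IsUpperSet (B i)) :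
    0 ≤ sahiE (bernoulliWeight (Sum.elim p₁ p₂)) 3
      (fun i => ind {ω : Set (ι₁ ⊕ ι₂) | Sum.inl ⁻¹' ω ∈ A i ∧ Sum.inr ⁻¹' ω ∈ B i}) :=
  sahiE_separable_nonneg p₁ p₂ 2 (sahiPositive_bernoulliWeight_le_three_of_card_le_four hι₁ p₁)
    (sahiPositive_bernoulliWeight_le_three_of_card_le_four hι₂ p₂) A B hA hB

/-- All orders of the product weight on at most three coins (`2^X`, `|X| ≤ 3`, is settled: tree `SahiCubeAllOrders.sahiPositive_set_of_card_le_three`).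
[this work] -/
theorem sahiPositive_bernoulliWeight_all_of_card_le_three (hι : Fintype.card ι₁ ≤ 3) (p : ι₁ → unitInterval) (m : ℕ) :
    ∀ L ≤ m, SahiPositive (bernoulliWeight p) L :=
  fun L _ => SahiCubeAllOrders.sahiPositive_set_of_card_le_three hι (isFKGMeasure_bernoulliWeight p) L

/-- **Separable families on `≤ 3 + 3` coins are Sahi-positive of EVERY order, unconditionally**: on `2^{ι₁ ⊔ ι₂}` with
`|ι₁|, |ι₂| ≤ 3` and any product measure, every family `(A_i ⊠ B_i)_{i ≤ n}` of separable increasing events has `E_{n+1} ≥ 0` — e.g. on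
`{0,1}⁴ = {0,1}² × {0,1}²` the one-step-residual quadruple `(x₁(x₃∨x₄), x₂(x₃∨x₄), x₃(x₁∨x₂), x₄(x₁∨x₂))` (antichain, no cylinder, no
independent member, no total-meet member) is covered. [this work] -/
theorem sahiE_separable_nonneg_of_card_le_three (hι₁ : Fintype.card ι₁ ≤ 3) (hι₂ : Fintype.card ι₂ ≤ 3)
    (p₁ : ι₁ → unitInterval) (p₂ : ι₂ → unitInterval) (n : ℕ) (A : Fin (n + 1) → Set (Set ι₁)) (B : Fin (n + 1) → Set (Set ι₂))
    (hA : ∀ i, IsUpperSet (A i)) (hB : ∀ i, IsUpperSet (B i)) :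
    0 ≤ sahiE (bernoulliWeight (Sum.elim p₁ p₂)) (n + 1)
      (fun i => ind {ω : Set (ι₁ ⊕ ι₂) | Sum.inl ⁻¹' ω ∈ A i ∧ Sum.inr ⁻¹' ω ∈ B i}) :=
  sahiE_separable_nonneg p₁ p₂ n (sahiPositive_bernoulliWeight_all_of_card_le_three hι₁ p₁ (n + 1))
    (sahiPositive_bernoulliWeight_all_of_card_le_three hι₂ p₂ (n + 1)) A B hA hB

end SahiTotalCumulance

end Summit.CriticalPhenomena.PercolationContinuityZ3.Theorems

end
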